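import Summits.ValiantsHypothesis.ValiantsHypothesis.Theorems.LacunarySymmetroidMatrixDescartesPivotTwoDirectionsPosEnds

/-!
# `MatrixDescartes` census — TWO-DIRECTION PENCILS AT EVERY SIZE `m` REDUCE TO THE `(2,K)` SCALAR FORM
# (Weinstein–Aronszajn): `det (X^e J + f·uuᵀ + g·vvᵀ) = X^{(m−2)e}·[X^{2e}·det J + X^e·(f·μ_u + g·μ_v) + f g·δ]`;
# SIZE-FREE LAWS: `Z₊ ≤ 2(#supp f + #supp g) + 2` for ANY non-singular pivot, and the `m = 2` two-direction laws verbatim in the weak hard cell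

HONEST FRAMING.  Object-search cell `pub-symmetroid`, Conjecture-B column in PIVOT currency (`…CensusPivotDefs.lean`, seat conjb-1), seat
`val-sym-mdr-p2` (generation 25); helper file `--supports` the crux item stmt-ValiantsHypothesis-18050 (`Theses.LacunarySymmetroid.MatrixDescartes`,
OPEN, on HOLD) with NO closure claim.  Director's docket for this seat: «format-level upper bounds at FAT formats».  The two-direction family of
`…PivotTwoDirections` / `…Ends` / `…PosEnds` (letters rank one, in two directions `u, v`) was typed at size `m = 2`; here the SAME scalar
`Φ = X^{2e}·dJ + X^e f·mu + X^e g·mv + f g·D2` governs EVERY size: for an `m × m` real matrix `J` with `det J ≠ 0` (no symmetry, no index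
hypothesis), vectors `u, v` and polynomials `f, g`,
  `det (X^e J + f·uuᵀ + g·vvᵀ) = X^{(m−2)e} · Φ`  with  `dJ = det J`, `mu = det J·(uᵀJ⁻¹u)`, `mv = det J·(vᵀJ⁻¹v)`,
  `D2 = det J·((uᵀJ⁻¹u)(vᵀJ⁻¹v) − (uᵀJ⁻¹v)(vᵀJ⁻¹u))`
(`det_twoDir_anySize`; the rank-two Weinstein–Aronszajn identity `det(A + UV) = det A·det(1 + V A⁻¹ U)`, Mathlib `Matrix.det_add_mul`, at every
real point, then polynomial identity).  At `m = 2` these are `det J`, `m(J,u)`, `m(J,v)`, `Δ²` of `TwoDirections.det_twoDir`.  Consequences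
(sizes `m ≥ 2`, written `Fin (m + 2)`):
* `card_posRoots_twoDir_anySize_eq` — the positive determinant roots ARE those of `Φ` (same finite set);
* **`posRoots_twoDir_anySize_le`** — SIZE-FREE DESCARTES: `Z₊ ≤ 2·(#supp f + #supp g) + 2` for `f, g` of non-negative coefficients and ANY
  non-singular `J` (negative — or, when `D2 < 0`, positive — coefficients of `Φ` sit at the pivot-type degrees `2e`, `e + supp f`, `e + supp g`);
  so rank-one letters in two directions form a format family with a bound LINEAR in the number of letters at every size (the general
  index-one ceiling is the resolvent count `2·C(K+m−1, m−1)`, `…CensusPivotResolventDescartes`);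
* **`posRoots_twoDir_anySize_add_ends_le`**, **`posRoots_twoDir_anySize_lone_letter`**, `posRoots_twoDir_anySize_signSeparated` — in the
  size-`m` WEAK HARD CELL (`det J ≤ 0`, `mu ≤ 0`, `mv ≤ 0`, `D2 > 0`; for an index-one symmetric `J`: `uᵀJ⁻¹u ≥ 0`, `vᵀJ⁻¹v ≥ 0`, `WᵀJ⁻¹W`
  indefinite) the `(2,K)` two-direction laws hold VERBATIM at every size: positive-support count with ends (`PosEnds`), the lone-letter bound
  `2·#supp g − 1`, the sign-separated `2K` (`Ends`).
Nothing here bears on `Theses.LacunarySymmetroid.MatrixDescartes` in its window, on `KPlusLogSqLaw`, on `DoorA26` / `DoorA34`, on the cell's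
registers or credences, or on `VP ≠ VNP`.

[folklore] Weinstein–Aronszajn / matrix determinant lemma (Mathlib `Matrix.det_add_mul`), evaluation of polynomial determinants
(`RingHom.map_det`), `Polynomial.eq_of_infinite_eval_eq`, Descartes with a support budget (tree `Pivot.TwoDescartes.card_posRoots_le_two_mul_card`,
`TwoDirections.Ends.negSupp_subset`, `…PosEnds`).  No definitions, no named facts.
-/

-- `Summit.ValiantsHypothesis.ValiantsHypothesis.…` repeats a component by the D-0017 layout
-- (single-conjunct summit), which the `dupNamespace` linter flags; the name is mandated.
set_option linter.dupNamespace false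

namespace Summit.ValiantsHypothesis.ValiantsHypothesis.Theorems.LacunarySymmetroidMatrixDescartes.Pivot.TwoDirections.AnySize

open Polynomial Matrix Finset
open scoped BigOperators

variable {n : ℕ}

/-! ## 1. The rank-two factorisation `f·uuᵀ + g·vvᵀ = U V` and the `2 × 2` core -/

/-- `[a·u | b·v] · [u ; v] = a·uuᵀ + b·vvᵀ`. [folklore] -/
theorem colPair_mul_rowPair (u v : Fin n → ℝ) (a b : ℝ) :
    (Matrix.of fun (i : Fin n) (j : Fin 2) => if j = 0 then a * u i else b * v i)
        * (Matrix.of fun (j : Fin 2) (i : Fin n) => if j = 0 then u i else v i)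
      = a • vecMulVec u u + b • vecMulVec v v := by
  ext i k
  simp [Matrix.mul_apply, Fin.sum_univ_two, vecMulVec_apply]
  ring

/-- `[u ; v] · B · [a·u | b·v]` is the `2 × 2` matrix of the `B`-pairings. [folklore] -/
theorem rowPair_mul_mul_colPair (B : Matrix (Fin n) (Fin n) ℝ) (u v : Fin n → ℝ) (a b : ℝ) :
    (Matrix.of fun (j : Fin 2) (i : Fin n) => if j = 0 then u i else v i) * B
        * (Matrix.of fun (i : Fin n) (j : Fin 2) => if j = 0 then a * u i else b * v i)
      = !![a * (u ⬝ᵥ B *ᵥ u), b * (u ⬝ᵥ B *ᵥ v); a * (v ⬝ᵥ B *ᵥ u), b * (v ⬝ᵥ B *ᵥ v)] := by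
  rw [Matrix.mul_assoc]
  ext j k
  fin_cases j <;> fin_cases k <;>
    simp [Matrix.mul_apply, dotProduct, mulVec, Finset.mul_sum, mul_comm, mul_left_comm]

/-- `det (1 + !![p, q; r, s]) = (1 + p)(1 + s) − q r`. [folklore] -/
theorem det_one_add_two (p q r s : ℝ) : (1 + !![p, q; r, s]).det = (1 + p) * (1 + s) - q * r := by
  rw [Matrix.det_fin_two]
  simp [Matrix.add_apply]

/-! ## 2. The pointwise Weinstein–Aronszajn identity -/

/-- **Pointwise reduction.**  For `det J ≠ 0`, `x ≠ 0` and reals `a, b`: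
`det (x^e J + a·uuᵀ + b·vvᵀ) = (x^e)^n · det J · [(1 + x^{−e} a (uᵀJ⁻¹u))(1 + x^{−e} b (vᵀJ⁻¹v)) − x^{−2e} a b (uᵀJ⁻¹v)(vᵀJ⁻¹u)]`. [folklore] -/
theorem det_twoDir_point (e : ℕ) (J : Matrix (Fin n) (Fin n) ℝ) (hJ : J.det ≠ 0) (u v : Fin n → ℝ) (a b x : ℝ) (hx : x ≠ 0) :
    (x ^ e • J + a • vecMulVec u u + b • vecMulVec v v).det
      = (x ^ e) ^ n * J.det *
        ((1 + (x ^ e)⁻¹ * a * (u ⬝ᵥ J⁻¹ *ᵥ u)) * (1 + (x ^ e)⁻¹ * b * (v ⬝ᵥ J⁻¹ *ᵥ v))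
          - (x ^ e)⁻¹ * b * (u ⬝ᵥ J⁻¹ *ᵥ v) * ((x ^ e)⁻¹ * a * (v ⬝ᵥ J⁻¹ *ᵥ u))) := by
  have hxe : x ^ e ≠ 0 := pow_ne_zero _ hx
  have hA : IsUnit (x ^ e • J).det := by
    rw [det_smul, Fintype.card_fin]
    exact (mul_ne_zero (pow_ne_zero _ hxe) hJ).isUnit
  have hinv : (x ^ e • J)⁻¹ = (x ^ e)⁻¹ • J⁻¹ := by
    refine Matrix.inv_eq_right_inv ?_
    rw [smul_mul_smul_comm, mul_inv_cancel₀ hxe, one_smul, Matrix.mul_nonsing_inv J hJ.isUnit]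
  rw [add_assoc, ← colPair_mul_rowPair u v a b, Matrix.det_add_mul _ _ hA, hinv, det_smul, Fintype.card_fin]
  rw [show (Matrix.of fun (j : Fin 2) (i : Fin n) => if j = 0 then u i else v i) * ((x ^ e)⁻¹ • J⁻¹)
      * (Matrix.of fun (i : Fin n) (j : Fin 2) => if j = 0 then a * u i else b * v i)
      = (Matrix.of fun (j : Fin 2) (i : Fin n) => if j = 0 then u i else v i) * J⁻¹
      * (Matrix.of fun (i : Fin n) (j : Fin 2) => if j = 0 then ((x ^ e)⁻¹ * a) * u i else ((x ^ e)⁻¹ * b) * v i) by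
    rw [Matrix.mul_smul, Matrix.smul_mul, ← Matrix.mul_smul]
    congr 1
    ext i j
    simp only [Matrix.smul_apply, Matrix.of_apply, smul_eq_mul]
    split_ifs <;> ring]
  rw [rowPair_mul_mul_colPair, det_one_add_two]

/-! ## 3. The polynomial identity at sizes `m ≥ 2` -/

/-- Evaluation commutes with the determinant of the two-direction pencil. [folklore] -/
theorem eval_det_twoDir (e : ℕ) (J : Matrix (Fin n) (Fin n) ℝ) (u v : Fin n → ℝ) (f g : ℝ[X]) (x : ℝ) :
    (Matrix.det (((X : ℝ[X]) ^ e) • J.map Polynomial.C + f • (vecMulVec u u).map Polynomial.C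
        + g • (vecMulVec v v).map Polynomial.C)).eval x
      = (x ^ e • J + f.eval x • vecMulVec u u + g.eval x • vecMulVec v v).det := by
  have h := RingHom.map_det (Polynomial.evalRingHom x)
    (((X : ℝ[X]) ^ e) • J.map Polynomial.C + f • (vecMulVec u u).map Polynomial.C + g • (vecMulVec v v).map Polynomial.C)
  rw [Polynomial.coe_evalRingHom] at h
  rw [h]
  congr 1
  ext i j
  simp only [RingHom.mapMatrix_apply, Matrix.map_apply, Matrix.add_apply, Matrix.smul_apply, smul_eq_mul,
    Polynomial.coe_evalRingHom, Polynomial.eval_add, Polynomial.eval_mul, Polynomial.eval_pow, Polynomial.eval_X,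
    Polynomial.eval_C]

/-- **THE REDUCTION IDENTITY** (sizes `m + 2 ≥ 2`).  For `J` with `det J ≠ 0`:
`det (X^e J + f·uuᵀ + g·vvᵀ) = X^{m e} · (X^{2e}·C dJ + X^e·f·C mu + X^e·g·C mv + f·g·C D2)` with
`dJ = det J`, `mu = det J·(uᵀJ⁻¹u)`, `mv = det J·(vᵀJ⁻¹v)`, `D2 = det J·((uᵀJ⁻¹u)(vᵀJ⁻¹v) − (uᵀJ⁻¹v)(vᵀJ⁻¹u))`. [this file] -/
theorem det_twoDir_anySize {m : ℕ} (e : ℕ) (J : Matrix (Fin (m + 2)) (Fin (m + 2)) ℝ) (hJ : J.det ≠ 0)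
    (u v : Fin (m + 2) → ℝ) (f g : ℝ[X]) :
    Matrix.det (((X : ℝ[X]) ^ e) • J.map Polynomial.C + f • (vecMulVec u u).map Polynomial.C
        + g • (vecMulVec v v).map Polynomial.C)
      = (X : ℝ[X]) ^ (m * e) *
        ((X : ℝ[X]) ^ (2 * e) * Polynomial.C J.det
          + (X : ℝ[X]) ^ e * f * Polynomial.C (J.det * (u ⬝ᵥ J⁻¹ *ᵥ u))
          + (X : ℝ[X]) ^ e * g * Polynomial.C (J.det * (v ⬝ᵥ J⁻¹ *ᵥ v))
          + f * g * Polynomial.C (J.det * ((u ⬝ᵥ J⁻¹ *ᵥ u) * (v ⬝ᵥ J⁻¹ *ᵥ v) - (u ⬝ᵥ J⁻¹ *ᵥ v) * (v ⬝ᵥ J⁻¹ *ᵥ u)))) := by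
  refine Polynomial.eq_of_infinite_eval_eq _ _ ((Set.Ioi_infinite (0 : ℝ)).mono fun x hx => ?_)
  have hx : (x : ℝ) ≠ 0 := ne_of_gt hx
  simp only [Set.mem_setOf_eq]
  rw [eval_det_twoDir, det_twoDir_point e J hJ u v (f.eval x) (g.eval x) x hx]
  simp only [Polynomial.eval_add, Polynomial.eval_mul, Polynomial.eval_pow, Polynomial.eval_X, Polynomial.eval_C]
  have hxe : x ^ e ≠ 0 := pow_ne_zero _ hx
  field_simp
  ring

/-! ## 4. Roots: the size-`m` pencil and the scalar `Φ` have the same positive roots -/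

/-- Positive roots are unchanged by a factor `X^N`. [folklore] -/
theorem posRoots_X_pow_mul (N : ℕ) (Ψ : ℝ[X]) :
    ((X ^ N * Ψ).roots.toFinset.filter (fun t => 0 < t)) = (Ψ.roots.toFinset.filter (fun t => 0 < t)) := by
  classical
  rcases eq_or_ne Ψ 0 with h0 | h0
  · simp [h0]
  · ext t
    simp only [Finset.mem_filter, Multiset.mem_toFinset, Polynomial.roots_mul (mul_ne_zero (pow_ne_zero N X_ne_zero) h0),
      Multiset.mem_add, Polynomial.roots_X_pow, Multiset.mem_nsmul, Multiset.mem_singleton]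
    constructor
    · rintro ⟨h | h, ht⟩
      · exact absurd h.2 (ne_of_gt ht)
      · exact ⟨h, ht⟩
    · rintro ⟨h, ht⟩
      exact ⟨Or.inr h, ht⟩

/-- **Same positive roots** (sizes `m + 2`, `det J ≠ 0`): the positive determinant roots of the size-`m` two-direction pencil are exactly
the positive roots of the `(2,K)` scalar form `Φ`. [this file] -/
theorem posRoots_twoDir_anySize_eq {m : ℕ} (e : ℕ) (J : Matrix (Fin (m + 2)) (Fin (m + 2)) ℝ) (hJ : J.det ≠ 0)
    (u v : Fin (m + 2) → ℝ) (f g : ℝ[X]) :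
    ((Matrix.det (((X : ℝ[X]) ^ e) • J.map Polynomial.C + f • (vecMulVec u u).map Polynomial.C
        + g • (vecMulVec v v).map Polynomial.C)).roots.toFinset.filter (fun t => 0 < t))
      = (((X : ℝ[X]) ^ (2 * e) * Polynomial.C J.det
          + (X : ℝ[X]) ^ e * f * Polynomial.C (J.det * (u ⬝ᵥ J⁻¹ *ᵥ u))
          + (X : ℝ[X]) ^ e * g * Polynomial.C (J.det * (v ⬝ᵥ J⁻¹ *ᵥ v))
          + f * g * Polynomial.C (J.det * ((u ⬝ᵥ J⁻¹ *ᵥ u) * (v ⬝ᵥ J⁻¹ *ᵥ v) - (u ⬝ᵥ J⁻¹ *ᵥ v) * (v ⬝ᵥ J⁻¹ *ᵥ u)))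
          ).roots.toFinset.filter (fun t => 0 < t)) := by
  rw [det_twoDir_anySize e J hJ u v f g, posRoots_X_pow_mul]

/-! ## 5. Size-free laws -/

/-- **SIZE-FREE DESCARTES FOR TWO DIRECTIONS** (sizes `m + 2`; `f, g` of non-negative coefficients; ANY `J` with `det J ≠ 0` — no symmetry, no
index hypothesis): `Z₊ ≤ 2·(#supp f + #supp g) + 2`.  [If `D2 ≥ 0` the negative coefficients of `Φ` sit at the `≤ 1 + #supp f + #supp g`
pivot-type degrees (`Ends.negSupp_subset`); if `D2 < 0` the same holds for `−Φ`.] -/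
theorem posRoots_twoDir_anySize_le {m : ℕ} (e : ℕ) (J : Matrix (Fin (m + 2)) (Fin (m + 2)) ℝ) (hJ : J.det ≠ 0)
    (u v : Fin (m + 2) → ℝ) (f g : ℝ[X]) (hf0 : ∀ i, 0 ≤ f.coeff i) (hg0 : ∀ j, 0 ≤ g.coeff j) :
    ((Matrix.det (((X : ℝ[X]) ^ e) • J.map Polynomial.C + f • (vecMulVec u u).map Polynomial.C
        + g • (vecMulVec v v).map Polynomial.C)).roots.toFinset.filter (fun t => 0 < t)).card
      ≤ 2 * (f.support.card + g.support.card) + 2 := by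
  classical
  rw [posRoots_twoDir_anySize_eq e J hJ u v f g]
  set dJ := J.det
  set mu := J.det * (u ⬝ᵥ J⁻¹ *ᵥ u)
  set mv := J.det * (v ⬝ᵥ J⁻¹ *ᵥ v)
  set D2 := J.det * ((u ⬝ᵥ J⁻¹ *ᵥ u) * (v ⬝ᵥ J⁻¹ *ᵥ v) - (u ⬝ᵥ J⁻¹ *ᵥ v) * (v ⬝ᵥ J⁻¹ *ᵥ u))
  set Φ := (X : ℝ[X]) ^ (2 * e) * Polynomial.C dJ + (X : ℝ[X]) ^ e * f * Polynomial.C mu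
    + (X : ℝ[X]) ^ e * g * Polynomial.C mv + f * g * Polynomial.C D2 with hΦ
  set S : Finset ℕ := insert (2 * e) ((f.support.image fun i => i + e) ∪ (g.support.image fun j => j + e)) with hS
  have hScard : S.card ≤ 1 + (f.support.card + g.support.card) := by
    refine (Finset.card_insert_le _ _).trans ?_
    have := (Finset.card_union_le _ _).trans (Nat.add_le_add (Finset.card_image_le (s := f.support) (f := fun i => i + e))
      (Finset.card_image_le (s := g.support) (f := fun j => j + e)))
    omega
  -- the pivot-type degrees carry every coefficient of `Φ` that is not a multiple of `D2·(f g)`-type sums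
  have key : ∀ n, n ∉ S → Φ.coeff n = D2 * (f * g).coeff n := by
    intro n hn
    rw [hΦ, Ends.coeff_twoDirDet]
    rw [hS, Finset.mem_insert, Finset.mem_union, Finset.mem_image, Finset.mem_image] at hn
    push Not at hn
    obtain ⟨h2e, hf', hg'⟩ := hn
    have t1 : (if n = 2 * e then dJ else 0) = 0 := if_neg h2e
    have t2 : mu * (if e ≤ n then f.coeff (n - e) else 0) = 0 := by
      split_ifs with hle
      · have : f.coeff (n - e) = 0 := by
          by_contra hne
          exact hf' (n - e) (Polynomial.mem_support_iff.mpr hne) (by omega)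
        rw [this, mul_zero]
      · rw [mul_zero]
    have t3 : mv * (if e ≤ n then g.coeff (n - e) else 0) = 0 := by
      split_ifs with hle
      · have : g.coeff (n - e) = 0 := by
          by_contra hne
          exact hg' (n - e) (Polynomial.mem_support_iff.mpr hne) (by omega)
        rw [this, mul_zero]
      · rw [mul_zero]
    rw [t1, t2, t3]; ring
  have hfg : ∀ n, 0 ≤ (f * g).coeff n := Ends.coeff_mul_nonneg_of_nonneg f g hf0 hg0
  rcases le_or_gt 0 D2 with hD2 | hD2
  · -- negative coefficients only on `S`
    have h := Pivot.TwoDescartes.card_posRoots_le_two_mul_card Φ S (fun n hn => by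
      by_contra hnS
      have := key n hnS
      have : 0 ≤ Φ.coeff n := by rw [this]; exact mul_nonneg hD2 (hfg n)
      linarith)
    omega
  · -- positive coefficients only on `S`: apply the count to `−Φ`
    have h := Pivot.TwoDescartes.card_posRoots_le_two_mul_card (-Φ) S (fun n hn => by
      by_contra hnS
      have hk := key n hnS
      rw [Polynomial.coeff_neg] at hn
      have : Φ.coeff n ≤ 0 := by rw [hk]; exact mul_nonpos_of_nonpos_of_nonneg hD2.le (hfg n)
      linarith)
    rw [Polynomial.roots_neg] at h
    omega

/-- **POSITIVE-SUPPORT COUNT WITH ENDS AT EVERY SIZE** (weak hard cell of size `m + 2`: `det J ≤ 0`… here `det J < 0`, `mu ≤ 0`, `mv ≤ 0`,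
`D2 > 0`; `f, g ≠ 0` of non-negative coefficients):
`Z₊ + [tdeg f < e ∧ tdeg g < e] + [e < deg f ∧ e < deg g] ≤ 2·#(supp f + supp g)` (`PosEnds.posRoots_add_ends_le_two_mul_card_sumset`). -/
theorem posRoots_twoDir_anySize_add_ends_le {m : ℕ} (e : ℕ) (J : Matrix (Fin (m + 2)) (Fin (m + 2)) ℝ) (hJ : J.det < 0)
    (u v : Fin (m + 2) → ℝ) (f g : ℝ[X]) (hf : f ≠ 0) (hg : g ≠ 0) (hf0 : ∀ i, 0 ≤ f.coeff i) (hg0 : ∀ j, 0 ≤ g.coeff j)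
    (hmu : J.det * (u ⬝ᵥ J⁻¹ *ᵥ u) ≤ 0) (hmv : J.det * (v ⬝ᵥ J⁻¹ *ᵥ v) ≤ 0)
    (hD2 : 0 < J.det * ((u ⬝ᵥ J⁻¹ *ᵥ u) * (v ⬝ᵥ J⁻¹ *ᵥ v) - (u ⬝ᵥ J⁻¹ *ᵥ v) * (v ⬝ᵥ J⁻¹ *ᵥ u))) :
    ((Matrix.det (((X : ℝ[X]) ^ e) • J.map Polynomial.C + f • (vecMulVec u u).map Polynomial.C
        + g • (vecMulVec v v).map Polynomial.C)).roots.toFinset.filter (fun t => 0 < t)).card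
      + (if f.natTrailingDegree < e ∧ g.natTrailingDegree < e then 1 else 0)
      + (if e < f.natDegree ∧ e < g.natDegree then 1 else 0)
      ≤ 2 * ((f.support ×ˢ g.support).image (fun ij : ℕ × ℕ => ij.1 + ij.2)).card := by
  rw [posRoots_twoDir_anySize_eq e J hJ.ne u v f g]
  exact PosEnds.posRoots_add_ends_le_two_mul_card_sumset e f g _ _ _ _ hf hg hf0 hg0 hJ.le hmu hmv hD2

/-- **A LONE `u`-LETTER AT EVERY SIZE: `Z₊ ≤ 2·#supp g − 1`** (`f = a X^p`, `a > 0`, the lone letter with a `v`-letter on its side of the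
pivot; size-`m + 2` weak hard cell with `det J < 0`). [`PosEnds.posRoots_le_of_lone_letter`] -/
theorem posRoots_twoDir_anySize_lone_letter {m : ℕ} (e p : ℕ) (a : ℝ) (J : Matrix (Fin (m + 2)) (Fin (m + 2)) ℝ) (hJ : J.det < 0)
    (u v : Fin (m + 2) → ℝ) (g : ℝ[X]) (ha : 0 < a) (hg : g ≠ 0) (hg0 : ∀ j, 0 ≤ g.coeff j)
    (hmu : J.det * (u ⬝ᵥ J⁻¹ *ᵥ u) ≤ 0) (hmv : J.det * (v ⬝ᵥ J⁻¹ *ᵥ v) ≤ 0)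
    (hD2 : 0 < J.det * ((u ⬝ᵥ J⁻¹ *ᵥ u) * (v ⬝ᵥ J⁻¹ *ᵥ v) - (u ⬝ᵥ J⁻¹ *ᵥ v) * (v ⬝ᵥ J⁻¹ *ᵥ u)))
    (hside : (p < e ∧ g.natTrailingDegree < e) ∨ (e < p ∧ e < g.natDegree)) :
    ((Matrix.det (((X : ℝ[X]) ^ e) • J.map Polynomial.C + (Polynomial.C a * X ^ p) • (vecMulVec u u).map Polynomial.C
        + g • (vecMulVec v v).map Polynomial.C)).roots.toFinset.filter (fun t => 0 < t)).card + 1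
      ≤ 2 * g.support.card := by
  rw [posRoots_twoDir_anySize_eq e J hJ.ne u v (Polynomial.C a * X ^ p) g]
  exact PosEnds.posRoots_le_of_lone_letter e p a g _ _ _ _ ha hg hg0 hJ.le hmu hmv hD2 hside

/-- **SIGN-SEPARATED TWO-DIRECTION PENCILS AT EVERY SIZE: `Z₊ ≤ 2K`** (`u`-letters below the pivot, `v`-letters above; size-`m + 2` hard cell
with `det J < 0`, `mu, mv < 0`, `D2 ≥ 0`). [`Ends.twoDir_posRoots_le`] -/
theorem posRoots_twoDir_anySize_signSeparated {m : ℕ} (e : ℕ) (J : Matrix (Fin (m + 2)) (Fin (m + 2)) ℝ) (hJ : J.det < 0)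
    (u v : Fin (m + 2) → ℝ) (f g : ℝ[X]) (hf : f ≠ 0) (hg : g ≠ 0) (hf0 : ∀ i, 0 ≤ f.coeff i) (hg0 : ∀ j, 0 ≤ g.coeff j)
    (hfe : ∀ i, f.coeff i ≠ 0 → i < e) (hge : ∀ j, g.coeff j ≠ 0 → e < j)
    (hmu : J.det * (u ⬝ᵥ J⁻¹ *ᵥ u) < 0) (hmv : J.det * (v ⬝ᵥ J⁻¹ *ᵥ v) < 0)
    (hD2 : 0 ≤ J.det * ((u ⬝ᵥ J⁻¹ *ᵥ u) * (v ⬝ᵥ J⁻¹ *ᵥ v) - (u ⬝ᵥ J⁻¹ *ᵥ v) * (v ⬝ᵥ J⁻¹ *ᵥ u))) :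
    ((Matrix.det (((X : ℝ[X]) ^ e) • J.map Polynomial.C + f • (vecMulVec u u).map Polynomial.C
        + g • (vecMulVec v v).map Polynomial.C)).roots.toFinset.filter (fun t => 0 < t)).card
      ≤ 2 * (f.support.card + g.support.card) := by
  rw [posRoots_twoDir_anySize_eq e J hJ.ne u v f g]
  exact Ends.twoDir_posRoots_le e f g _ _ _ _ hf hg hf0 hg0 hfe hge hD2 hmu hmv

end Summit.ValiantsHypothesis.ValiantsHypothesis.Theorems.LacunarySymmetroidMatrixDescartes.Pivot.TwoDirections.AnySize
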